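import Mathlib.Analysis.Calculus.LineDeriv.IntegrationByParts
import Literature.Analysis.FluidPDE.GaussianVortexPlanar

/-!
# The Gaussian vortex solves `L G = 0` weakly (linear part of Gallay–Maekawa (4.2) at `λ = 0`)

Support file for `Literature.Analysis.FluidPDE.GaussianVortexPlanarProofs` (the `λ = 0` slice of
Gallay–Maekawa 2016, Thm. 4.1). For the Gaussian `G(x) = (4π)⁻¹e^{−|x|²/4}` (`gaussVortexProfile`)
and the operator `L = Δ + ½x·∇ + 1` (`strainedVorticityOperator 0`, Gallay–Wayne 2006, (1.8);
Gallay–Maekawa 2016, (4.3)) we prove the ADJOINT (distributional) identity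
`∫ G (Δφ − ½(x₀∂₀φ + x₁∂₁φ)) dx = 0` for every test function `φ`
(`integral_gauss_mul_adjointL`), which is the linear part of the weak formulation
`IsWeakAsymBurgersVortex 0 α (αG)`.

Proof: ONE integration by parts per coordinate
(`integral_mul_fderiv_eq_neg_fderiv_mul_of_integrable`): `∫ G ∂ᵢ∂ᵢφ = −∫ ∂ᵢG ∂ᵢφ = ∫ (xᵢ/2)G ∂ᵢφ`
because `∂ᵢG = −(xᵢ/2)G`; summing over `i` gives `∫ GΔφ = ½∫ G x·∇φ`. The integration by parts is
done for a general `C¹` weight `f` with `∂₀f = −((1+λ)x₀/2)f`, `∂₁f = −((1−λ)x₁/2)f`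
(`integral_mul_adjointL_eq_zero`: the adjoint form of `L_λ f = 0`, covering the anisotropic Gaussian
`𝒢_λ` of Gallay–Maekawa (4.4)). Also recorded: the Laplacian on `ℝ²` in coordinates
(`laplacian_eq_fin_two`), continuity and compact support of `Δφ`, `∇φ` and of the drift
term for test functions.

## References

* Th. Gallay, C. E. Wayne, *Existence and stability of asymmetric Burgers vortices*, J. Math.
  Fluid Mech. 9 (2007), (1.5), (1.8) (`LG = 0`). [GallayWayne2006]
* Th. Gallay, Y. Maekawa, *Existence and stability of viscous vortices*, arXiv:1610.08384, §4,
  (4.2)–(4.4) (PDF p. 15). [GallayMaekawa2016]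
-/

noncomputable section

open Set Function Filter MeasureTheory Metric
open scoped Laplacian InnerProductSpace RealInnerProductSpace ContDiff Topology

namespace Literature.Analysis.FluidPDE

/-! ### Coordinates -/

/-- `⟪x, eᵢ⟫ = xᵢ`. [folklore] -/
theorem inner_single_one_right (x : EuclideanSpace ℝ (Fin 2)) (i : Fin 2) :
    ⟪x, EuclideanSpace.single i (1 : ℝ)⟫ = x i := by
  simp [EuclideanSpace.inner_single_right]

/-- `G` is differentiable. [folklore] -/
theorem differentiable_gaussVortexProfile : Differentiable ℝ gaussVortexProfile :=
  (contDiff_gaussVortexProfile (n := 1)).differentiable (by simp)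

/-- `∂ᵥG(z) = −(G(z)/2) ⟪z, v⟫` (private copy of
`GaussianVortexPlanarProofs.fderiv_gaussVortexProfile_apply`, proved from
`hasStrictFDerivAt_norm_sq` so that this file does not depend on that module). [folklore] -/
private theorem fderiv_gaussVortexProfile_apply_aux (z v : EuclideanSpace ℝ (Fin 2)) :
    fderiv ℝ gaussVortexProfile z v = -(gaussVortexProfile z / 2) * ⟪z, v⟫ := by
  have hG : gaussVortexProfile = fun ξ : EuclideanSpace ℝ (Fin 2) =>
      (4 * Real.pi)⁻¹ * Real.exp ((-1 / 4) * ‖ξ‖ ^ 2) := by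
    funext ξ; simp only [gaussVortexProfile]; ring_nf
  have h1 : HasFDerivAt (fun ξ : EuclideanSpace ℝ (Fin 2) => ‖ξ‖ ^ 2) (2 • innerSL ℝ z) z :=
    (hasStrictFDerivAt_norm_sq z).hasFDerivAt
  have h2 := ((h1.const_mul (-1 / 4 : ℝ)).exp).const_mul (4 * Real.pi)⁻¹
  rw [hG, h2.fderiv]
  simp
  ring

/-! ### Test functions on `ℝ²`: Laplacian in coordinates, continuity, supports -/

section TestFunction

variable {φ : EuclideanSpace ℝ (Fin 2) → ℝ} (hφ : ContDiff ℝ ∞ φ) (hφc : HasCompactSupport φ)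
include hφ

/-- Partial derivatives of a smooth function are smooth. [folklore] -/
theorem contDiff_fderiv_apply_of_contDiff (v : EuclideanSpace ℝ (Fin 2)) :
    ContDiff ℝ ∞ fun y => fderiv ℝ φ y v :=
  (hφ.fderiv_right (m := ∞) (by simp)).clm_apply contDiff_const

/-- Partial derivatives of a smooth function are continuous. [folklore] -/
theorem continuous_fderiv_apply_of_contDiff (v : EuclideanSpace ℝ (Fin 2)) :
    Continuous fun y => fderiv ℝ φ y v :=
  (contDiff_fderiv_apply_of_contDiff hφ v).continuous

/-- The Laplacian on `ℝ²` in coordinates: `Δφ = ∂₀∂₀φ + ∂₁∂₁φ`. [folklore] -/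
theorem laplacian_eq_fin_two (x : EuclideanSpace ℝ (Fin 2)) :
    Δ φ x = fderiv ℝ (fun y => fderiv ℝ φ y (EuclideanSpace.single 0 (1 : ℝ))) x
        (EuclideanSpace.single 0 (1 : ℝ)) +
      fderiv ℝ (fun y => fderiv ℝ φ y (EuclideanSpace.single 1 (1 : ℝ))) x
        (EuclideanSpace.single 1 (1 : ℝ)) := by
  have hd : DifferentiableAt ℝ (fderiv ℝ φ) x :=
    ((hφ.fderiv_right (m := ∞) (by simp)).differentiable (by simp)).differentiableAt
  have hkey : ∀ v : EuclideanSpace ℝ (Fin 2),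
      fderiv ℝ (fun y => fderiv ℝ φ y v) x v = fderiv ℝ (fderiv ℝ φ) x v v := by
    intro v
    rw [fderiv_clm_apply hd (differentiableAt_const v)]
    simp
  rw [InnerProductSpace.laplacian_eq_iteratedFDeriv_orthonormalBasis φ
    (EuclideanSpace.basisFun (Fin 2) ℝ)]
  simp only [Fin.sum_univ_two, iteratedFDeriv_two_apply, EuclideanSpace.basisFun_apply,
    Matrix.cons_val_zero, Matrix.cons_val_one, hkey]

/-- The Laplacian of a smooth function is continuous. [folklore] -/
theorem continuous_laplacian_fin_two : Continuous (Δ φ) := by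
  rw [show Δ φ = _ from funext (laplacian_eq_fin_two hφ)]
  exact (continuous_fderiv_apply_of_contDiff (contDiff_fderiv_apply_of_contDiff hφ _) _).add
    (continuous_fderiv_apply_of_contDiff (contDiff_fderiv_apply_of_contDiff hφ _) _)

/-- The drift part `((1+λ)/2) x₀∂₀φ + ((1−λ)/2) x₁∂₁φ` of the adjoint operator is continuous.
[folklore] -/
theorem continuous_adjointDrift (lam : ℝ) : Continuous fun x : EuclideanSpace ℝ (Fin 2) =>
    (1 + lam) / 2 * x 0 * fderiv ℝ φ x (EuclideanSpace.single 0 (1 : ℝ)) +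
      (1 - lam) / 2 * x 1 * fderiv ℝ φ x (EuclideanSpace.single 1 (1 : ℝ)) :=
  ((continuous_const.mul (PiLp.continuous_apply 2 _ 0)).mul
    (continuous_fderiv_apply_of_contDiff hφ _)).add
    ((continuous_const.mul (PiLp.continuous_apply 2 _ 1)).mul
    (continuous_fderiv_apply_of_contDiff hφ _))

/-- The gradient of a smooth function is continuous. [folklore] -/
theorem continuous_gradient_fin_two : Continuous (gradient φ) :=
  (InnerProductSpace.toDual ℝ (EuclideanSpace ℝ (Fin 2))).symm.continuous.comp
    (hφ.continuous_fderiv (by simp))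

include hφc

/-- The Laplacian of a test function has compact support. [folklore] -/
theorem hasCompactSupport_laplacian_fin_two : HasCompactSupport (Δ φ) := by
  rw [show Δ φ = _ from funext (laplacian_eq_fin_two hφ)]
  exact ((hφc.fderiv_apply (𝕜 := ℝ) _).fderiv_apply (𝕜 := ℝ) _).add
    ((hφc.fderiv_apply (𝕜 := ℝ) _).fderiv_apply (𝕜 := ℝ) _)

omit hφ in
/-- The drift part of the adjoint operator applied to a test function has compact support.
[folklore] -/
theorem hasCompactSupport_adjointDrift (lam : ℝ) :
    HasCompactSupport fun x : EuclideanSpace ℝ (Fin 2) =>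
      (1 + lam) / 2 * x 0 * fderiv ℝ φ x (EuclideanSpace.single 0 (1 : ℝ)) +
        (1 - lam) / 2 * x 1 * fderiv ℝ φ x (EuclideanSpace.single 1 (1 : ℝ)) :=
  ((hφc.fderiv_apply (𝕜 := ℝ) _).mul_left).add ((hφc.fderiv_apply (𝕜 := ℝ) _).mul_left)

omit hφ in
/-- The gradient of a test function has compact support. [folklore] -/
theorem hasCompactSupport_gradient_fin_two : HasCompactSupport (gradient φ) := by
  refine (hφc.fderiv (𝕜 := ℝ)).mono ?_
  intro x hx
  simp only [mem_support, ne_eq, gradient] at hx ⊢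
  contrapose! hx
  simp [hx]

/-! ### Integration by parts against a Gaussian-type weight -/

/-- One integration by parts against a weight `f` with `∂ᵢf = −(κxᵢ/2) f`:
`∫ f ∂ᵢ∂ᵢφ = ∫ (κxᵢ/2) f ∂ᵢφ`. [folklore] -/
theorem integral_mul_fderiv_fderiv_of_fderiv_apply_eq {f : EuclideanSpace ℝ (Fin 2) → ℝ} {κ : ℝ}
    (i : Fin 2) (hf : Differentiable ℝ f) (hfc : Continuous f)
    (hfd : ∀ x, fderiv ℝ f x (EuclideanSpace.single i (1 : ℝ)) = -(κ * x i / 2) * f x) :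
    ∫ x, f x * fderiv ℝ (fun y => fderiv ℝ φ y (EuclideanSpace.single i (1 : ℝ)))
        x (EuclideanSpace.single i (1 : ℝ)) =
      ∫ x : EuclideanSpace ℝ (Fin 2), κ * x i / 2 * f x *
        fderiv ℝ φ x (EuclideanSpace.single i (1 : ℝ)) := by
  set e : EuclideanSpace ℝ (Fin 2) := EuclideanSpace.single i (1 : ℝ) with he
  have hc1 : Continuous fun y => fderiv ℝ φ y e := continuous_fderiv_apply_of_contDiff hφ _
  have hs1 : HasCompactSupport fun y => fderiv ℝ φ y e := hφc.fderiv_apply (𝕜 := ℝ) _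
  have hc2 : Continuous fun x => fderiv ℝ (fun y => fderiv ℝ φ y e) x e :=
    continuous_fderiv_apply_of_contDiff (contDiff_fderiv_apply_of_contDiff hφ _) _
  have hs2 : HasCompactSupport fun x => fderiv ℝ (fun y => fderiv ℝ φ y e) x e :=
    hs1.fderiv_apply (𝕜 := ℝ) _
  have hc3 : Continuous fun x : EuclideanSpace ℝ (Fin 2) => -(κ * x i / 2) * f x :=
    ((continuous_const.mul (PiLp.continuous_apply 2 _ i)).div_const _).neg.mul hfc
  rw [integral_mul_fderiv_eq_neg_fderiv_mul_of_integrable, ← integral_neg]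
  · refine integral_congr_ae (Eventually.of_forall fun x => ?_)
    simp only [hfd]
    ring
  · have : (fun x => fderiv ℝ f x e * fderiv ℝ φ x e) =
        fun x => -(κ * x i / 2) * f x * fderiv ℝ φ x e := funext fun x => by rw [hfd]
    rw [this]
    exact (hc3.mul hc1).integrable_of_hasCompactSupport hs1.mul_left
  · exact (hfc.mul hc2).integrable_of_hasCompactSupport hs2.mul_left
  · exact (hfc.mul hc1).integrable_of_hasCompactSupport hs1.mul_left
  · exact fun x _ => hf x
  · exact fun x _ => (contDiff_fderiv_apply_of_contDiff hφ _).differentiable (by simp) x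

/-- **Gaussian-type weights solve `L_λ f = 0` weakly.** If `f` is `C¹` with
`∂₀f = −((1+λ)x₀/2) f` and `∂₁f = −((1−λ)x₁/2) f` (e.g. `f = 𝒢_λ`, Gallay–Maekawa 2016, (4.4);
`f = G` for `λ = 0`), then `∫ f (Δφ − ((1+λ)/2 x₀∂₀φ + (1−λ)/2 x₁∂₁φ)) = 0` for every test function
`φ` — the adjoint (distributional) form of `L_λ f = 0`, `L_λ = Δ + (1+λ)/2 x₁∂₁ + (1−λ)/2 x₂∂₂ + 1`.
[cite: GallayMaekawa2016, (4.3)–(4.4)] -/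
theorem integral_mul_adjointL_eq_zero {f : EuclideanSpace ℝ (Fin 2) → ℝ} (lam : ℝ)
    (hf : Differentiable ℝ f) (hfc : Continuous f)
    (hfd0 : ∀ x, fderiv ℝ f x (EuclideanSpace.single 0 (1 : ℝ)) = -((1 + lam) * x 0 / 2) * f x)
    (hfd1 : ∀ x, fderiv ℝ f x (EuclideanSpace.single 1 (1 : ℝ)) = -((1 - lam) * x 1 / 2) * f x) :
    ∫ x : EuclideanSpace ℝ (Fin 2), f x *
      (Δ φ x - ((1 + lam) / 2 * x 0 * fderiv ℝ φ x (EuclideanSpace.single 0 (1 : ℝ)) +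
        (1 - lam) / 2 * x 1 * fderiv ℝ φ x (EuclideanSpace.single 1 (1 : ℝ)))) = 0 := by
  have hint : ∀ i : Fin 2, Integrable fun x => f x *
      fderiv ℝ (fun y => fderiv ℝ φ y (EuclideanSpace.single i (1 : ℝ))) x
        (EuclideanSpace.single i (1 : ℝ)) := fun i =>
    (hfc.mul (continuous_fderiv_apply_of_contDiff
      (contDiff_fderiv_apply_of_contDiff hφ _) _)).integrable_of_hasCompactSupport
      ((hφc.fderiv_apply (𝕜 := ℝ) _).fderiv_apply (𝕜 := ℝ) _).mul_left
  have hint' : ∀ (κ : ℝ) (i : Fin 2), Integrable fun x : EuclideanSpace ℝ (Fin 2) =>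
      κ * x i / 2 * f x * fderiv ℝ φ x (EuclideanSpace.single i (1 : ℝ)) := fun κ i =>
    ((((continuous_const.mul (PiLp.continuous_apply 2 _ i)).div_const _).mul hfc).mul
      (continuous_fderiv_apply_of_contDiff hφ _)).integrable_of_hasCompactSupport
      (hφc.fderiv_apply (𝕜 := ℝ) _).mul_left
  have h1 : ∫ x, f x * Δ φ x = ∫ x : EuclideanSpace ℝ (Fin 2),
      ((1 + lam) * x 0 / 2 * f x * fderiv ℝ φ x (EuclideanSpace.single 0 (1 : ℝ)) +
        (1 - lam) * x 1 / 2 * f x * fderiv ℝ φ x (EuclideanSpace.single 1 (1 : ℝ))) := by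
    simp_rw [laplacian_eq_fin_two hφ, mul_add]
    rw [integral_add (hint 0) (hint 1),
      integral_mul_fderiv_fderiv_of_fderiv_apply_eq hφ hφc 0 hf hfc hfd0,
      integral_mul_fderiv_fderiv_of_fderiv_apply_eq hφ hφc 1 hf hfc hfd1,
      ← integral_add (hint' _ 0) (hint' _ 1)]
  have h2 : Integrable fun x => f x * Δ φ x := by
    simp_rw [laplacian_eq_fin_two hφ, mul_add]; exact (hint 0).add (hint 1)
  have h3 : Integrable fun x : EuclideanSpace ℝ (Fin 2) => f x *
      ((1 + lam) / 2 * x 0 * fderiv ℝ φ x (EuclideanSpace.single 0 (1 : ℝ)) +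
        (1 - lam) / 2 * x 1 * fderiv ℝ φ x (EuclideanSpace.single 1 (1 : ℝ))) := by
    refine ((hint' (1 + lam) 0).add (hint' (1 - lam) 1)).congr (Eventually.of_forall fun x => ?_)
    simp only [Pi.add_apply]
    ring
  simp_rw [mul_sub]
  rw [integral_sub h2 h3, h1, sub_eq_zero]
  refine integral_congr_ae (Eventually.of_forall fun x => ?_)
  ring

/-- **The Gaussian solves `LG = 0` weakly** (`L = L₀ = Δ + ½x·∇ + 1`; stated with the literal
parameter `λ = 0` of `IsWeakAsymBurgersVortex`): `∫ G (Δφ − ½ (x₀∂₀φ + x₁∂₁φ)) = 0` for every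
test function `φ` (Gallay–Wayne 2006, `LG = 0` after (1.8); Gallay–Maekawa 2016, after (4.3)).
[cite: GallayMaekawa2016, (4.3)] -/
theorem integral_gauss_mul_adjointL (lam : ℝ) (hlam : lam = 0) :
    ∫ x : EuclideanSpace ℝ (Fin 2), gaussVortexProfile x *
      (Δ φ x - ((1 + lam) / 2 * x 0 * fderiv ℝ φ x (EuclideanSpace.single 0 (1 : ℝ)) +
        (1 - lam) / 2 * x 1 * fderiv ℝ φ x (EuclideanSpace.single 1 (1 : ℝ)))) = 0 := by
  subst hlam
  refine integral_mul_adjointL_eq_zero hφ hφc 0 differentiable_gaussVortexProfile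
    (contDiff_gaussVortexProfile (n := 0)).continuous (fun x => ?_) (fun x => ?_)
  · rw [fderiv_gaussVortexProfile_apply_aux, inner_single_one_right]; ring
  · rw [fderiv_gaussVortexProfile_apply_aux, inner_single_one_right]; ring

end TestFunction

end Literature.Analysis.FluidPDE
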